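import Mathlib
import HarnessLib
import Summits.HubbardSuperconductivity.HubbardSuperconductivity.Theses.WeakCouplingBCS
import Summits.HubbardSuperconductivity.HubbardSuperconductivity.Theses.ChiralWindow
import Literature.MathematicalPhysics.QuantumLattice.DWaveOrderParameterProofs
import Literature.MathematicalPhysics.QuantumLattice.HubbardGrandCanonicalDensity
import Summits.HubbardSuperconductivity.HubbardSuperconductivity.Theorems.WeakCouplingBCSWcbcsBcsConstructionEnergyDensityLimit
import Summits.HubbardSuperconductivity.HubbardSuperconductivity.Theorems.WeakCouplingBCSWcbcsBcsConstructionRegularEquationOfState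
import Summits.HubbardSuperconductivity.HubbardSuperconductivity.Theorems.WeakCouplingBCSWcbcsBcsConstructionAeDensityConvergence
import Summits.HubbardSuperconductivity.HubbardSuperconductivity.Theorems.WeakCouplingBCSWcbcsBcsConstructionThinSufficiency
import Summits.HubbardSuperconductivity.HubbardSuperconductivity.Theorems.WcbcsBcsConstruction.Negative.UniformCeiling
import Summits.HubbardSuperconductivity.HubbardSuperconductivity.Theorems.ChiralWindowCwChiralConstructionKLWindowOfPoint
import Summits.HubbardSuperconductivity.HubbardSuperconductivity.Theorems.ChiralWindowCwChiralConstructionOfKLMechanism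
import Summits.HubbardSuperconductivity.HubbardSuperconductivity.Theorems.ChiralWindowCwChiralConstructionFillingAtNegThreeTenths
import Summits.HubbardSuperconductivity.HubbardSuperconductivity.Theorems.ChiralWindowCwChiralConstructionLevelWindowTransfer
import Summits.HubbardSuperconductivity.HubbardSuperconductivity.Theorems.ChiralWindowCwChiralConstructionFreeBandLimit
import Summits.HubbardSuperconductivity.HubbardSuperconductivity.Theorems.ChiralWindowCwChannelInfContinuousFilling
import Summits.HubbardSuperconductivity.HubbardSuperconductivity.Theorems.ChiralWindowCwKLChiralWindowBlockBoundsX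
import Summits.HubbardSuperconductivity.HubbardSuperconductivity.Theorems.ChiralWindowCwKLChiralWindowStubKlFillingLower
import Summits.HubbardSuperconductivity.HubbardSuperconductivity.Theorems.ChiralWindowCwChiralConstructionKptOfPointLeading
import Summits.HubbardSuperconductivity.HubbardSuperconductivity.Theorems.ChiralWindowCwChiralConstructionPointLeadingOfBox
import Summits.HubbardSuperconductivity.HubbardSuperconductivity.Theorems.ChiralWindowDefsPointRecord
import Summits.HubbardSuperconductivity.HubbardSuperconductivity.Theorems.WeakCouplingBCSWcbcsBcsConstructionGcDensitySandwichFree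
import Summits.HubbardSuperconductivity.HubbardSuperconductivity.Theorems.WeakCouplingBCSWcbcsBcsConstructionThinCruxOfChiralConstruction

/-!
# Crux `WcbcsBcsConstruction` — line `ladder-scale-certified-chain`, rev c5-2 (continuation lead c5, 2026-08-17)

Crux item stmt-HubbardSuperconductivity-2010, route `HubbardSuperconductivity/WeakCouplingBCS`:
`∃ δ ∈ (0,1/2) ∃ U₀ > 0 ∃ C > 0 ∀ U ∈ (0,U₀) ∃ μ`, (D) the grand-canonical tracial ground-state density of
`hubbardTorusWith 2 (L+1) 1 U μ` tends to `1 - δ` AND (O) `exp(-C/U²) ≤ dWaveOrderParameter U μ`.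

## REV c5-1 — CONSOLIDATION WITH THE SIBLING CRUX stmt-1740 (`ChiralWindow.CwChiralConstruction`, line `ladder-scale-transfer` rev c7-1)

Same line, same composition idea (certified Kohn–Luttinger input → the weak-coupling symmetric+broken RG core on a level window →
equation of state / density matching), RESHAPED so that this crux and its sibling hang on the SAME two open leaves:

* KL INPUT.  rev c4-3's (K1) `stub_klB1gLeadingOne` — `B₁g` leading at `U = 1` UNIFORMLY on `μ ∈ [-9/10, -3/10]`, all five irreps, a
  window certificate nothing like which has landed in 30 h of the stmt-0158/1741 enclosure lane — is REPLACED by the sibling lead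
  1740-c7's ONE-POINT `U = 1` certificate at `μ_pt = -21/25` (`n = 0.663`, `δ₀ = 0.337`; float census there: `Λ₁(B1g) = -0.0648` leads
  `B2g/E/A1g/A2g` by `×3.7`), i.e. the three stubs (P1) `stub_kptOfPointLeading` [M, provable now], (P2) `stub_pointLeadingOfBox`
  [S, provable now: certificate logic of ONE box in stmt-1741's `KLBox` vocabulary, `Theorems.stub_klBlockBoundsX` landed], (P3)
  `stub_klPointCertificate` [the certified COMPUTATION: seven loose inequalities at one `μ`] — BYTE-FOR-BYTE the statements registered on
  stmt-1740 (rev c7-1), so ONE proof of each closes it on BOTH cruxes — read through the LANDED point ⇒ level-window lemma (Kwin)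
  `Theorems.stub_klLeadingMuWindowOfPoint` (p141740) and the landed certified fillings `n(-2) ≤ 1/2` (`filling_neg_two_le_half'`, p142734),
  `7/10 ≤ n(-3/10)` (`stub_fillingAtNegThreeTenths`, p141417): a level window `[μ₁, μ₂] ⊂ [-2, -3/10]` with free fillings in `(13/25, 7/10)`
  on which `B₁g` leads every other channel by `γU²` for all `U < U₁` (`klLeadingLevelWindow`, proved below).
* CORE.  rev c3-1's merged stub (M) `stub_dWaveOrderFloorOnWindow` (floor uniform on `[-21/25, -7/20]` given (K1)) is RESTATED as the sibling's
  LOCAL UNIFORM form (M_loc) `stub_dWaveOrderFloorOnLeadingWindows` — VERBATIM stmt-1740's registered research stub (of which (M) is the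
  instance `[-9/10, -3/10]`, `siblingFloor_of_leadingWindows` in the sibling skeleton; lead 1740-c5 and lead 2010-c4 concur: ONE promoted item
  serves both cruxes).  It is the open weak-coupling constructive programme (symmetric flow below `e^{-a/U}` + `h`-seeded broken regime);
  registered FOR PROMOTION, no worker is seated on it.  The certificate-chain refinement (R1)/(Rloc) → (B) → (M)/(M_loc) of revs c2-1…c4-3 is
  kept in the sibling skeleton (`dWaveOrderFloorOnLeadingWindows_of_certificateChain`) and in this file's git history (rev c4-3, commit
  c836aefa); lead c3's interface audit (`R1B-interface-leak.md`) explains why it is a refinement and not a cut.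
* THIN CHAIN (summit level) — NO STUB OF ITS OWN ANY MORE.  New and kernel-checked this cycle: `CwChiralConstruction → thin crux 2010`
  (`thinCrux_of_cwChiralConstruction`: `δ(U) ∈ [3/10, 12/25] ⊂ (0, 1/2)`), so crux 2 `WcbcsSsbToTorusLRO` + stmt-1740 ⇒ SUMMIT
  (`hubbardSuperconductivity_of_ssbToTorusLRO_of_cwChiralConstruction`, landed separately as a `--supports` file with the sibling crux spelled
  out).  Inside this skeleton the sibling crux itself follows from (P1)(P2)(P3)(M_loc) by the sibling's landed record-free transfer
  `Theorems.stub_cruxOfOrderFloorOnCertifiedLevelWindow` (p142268) — `cwChiralConstruction_of_chain` — hence the thin crux and (with crux 2)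
  the summit: rev c4-1's (T1)(T2)(T3)(M′) leave the skeleton (all but (M′) landed; (M′) is implied: `thinOrder` is not needed).
* TYPED CHAIN (the crux BY NAME, `U`-uniform `δ`, rate `e^{-C/U²}`).  `WcbcsBcsConstruction_of` is sorry-free from (P1)(P2)(P3)(M_loc) and
  two stubs on the equation-of-state side: (D_loc) `stub_noDensityJumpOnLevelWindows` [research: no first-order density jump on level
  windows inside `[-2, -3/10]` at weak coupling — rev c2-2's (D1a) moved to the window the KL input actually delivers; needed ONLY for the
  `U`-uniform `δ`] and (Bgen) `stub_gcDensitySandwichFree` [M, provable now: the generic free/interacting sandwich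
  `F(μ-r) - U/r ≤ liminf n_L(U,μ) ≤ limsup n_L(U,μ) ≤ F(μ+r) + U/r`, `F` the free filling — replaces the certified level counts (D1b)/(D1c)/(T1)/(T2)
  of revs c2–c4, which were tied to literal window ends].  Composition: window `[m, μ₂]`, `m = (μ₁+μ₂)/2` (inside `[μ₁ + U/2, μ₂]` for
  `U ≤ μ₂ - μ₁`); `r = (μ₂ - m)/6`; brackets `1 - b := F(m+2r) < F(μ₂-2r) =: 1 - a` (strictly monotone free filling on `[-4,4]`), inside
  `(1/2, 1)` by the certified fillings; (D_loc) makes `e(U,·)` differentiable on `[m, μ₂]` (landed `wcbcs_eos_differentiableAt_of_noDensityJump`),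
  Griffiths gives the density limits `-e'` there, (Bgen) with `U ≤ r·min(F(m+2r)-F(m+r), F(μ₂-r)-F(μ₂-2r))` places `-e'(m) ≤ 1-b`,
  `1-a ≤ -e'(μ₂)`; Darboux (`exists_tendsto_gcDensity_of_regularWindow`) picks `μ(U) ∈ [m, μ₂]` with density `→ 1 - a`; (M_loc) gives the floor
  there.  `δ := a`, `U₀ := min U₀ᴹ (min U_J (min U_B (μ₂ - μ₁)))`, `C := Cᴹ`.

REV c5-2 (same day, after wave 1): (P1) LANDED p146657 and (P2) LANDED p148296 by the sibling lead 1740-c7 (same statements — the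
consolidation paid off within the hour), (Bgen) LANDED p148887 (this seat's worker), the cross-route glue LANDED p146793; (P3) is now
WITNESSED by the sibling's concrete record (`ChiralWindowDefsPointRecord.lean`, p145573, kernel-decided Booleans `klPt_okX`) modulo the new
shared stub (Penc) `stub_klPointEnclosure` — ten certified integral inequalities at ONE level, the only non-research leaf left on either
crux.  Sorries 3: (Penc) [certified computation, ccert lane target `Cruxes/CwChiralConstruction/PointCertTarget.md`], (M_loc) [research,
promote], (D_loc) [research, typed chain only].

Registered stubs after rev c5-1 (6 ≤ stubs_max): (P1) (P2) (P3) [shared with stmt-1740, provable/provable/certified computation],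
(M_loc) [shared research core ⇒ PROMOTE as one item wanted by both routes], (D_loc) [research, typed chain only], (Bgen) [provable now].
Dropped: (K1) (superseded window certificate), (M) (instance of (M_loc)), (D1a) (re-windowed as (D_loc)), (M′) (implied; thin chain now
runs through the sibling crux), and the closed (T1)(T2)(T3)(D1b)(D1c)(R0′) (landed; no longer consumed).

## Costume tests / Disproof used
Unchanged from rev c4-3: (T-h)(T-L)(T-g) passed by construction ((M_loc) concludes on `dWaveOrderParameter` itself, uniform on a level
window, with an explicit KL hypothesis — a statement about the constructive programme, not a limit-axis restatement of the crux);
`Disproof.lean` v3 (2026-08-16T08:35Z, re-read 2026-08-17T07:00Z): no `_false_without_`, no `-- Targets`; S1/S2 honoured (source on,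
punctured filter), S3 (`U = 0` excluded: open interval), `Negative/UniformCeiling` imported as `ceiling_anchor` (`e^{-C/U²} ≪ 71U^{1/4}`).

## History (one line per rev; details in git and in `Cruxes/WcbcsBcsConstruction/*.md`)
strategist rev 2 (K)(R)(B)(D); c2-1…c2-3 (K)⟸(K1), (R)⟸(R0′)+(R1), (D)⟸(D1a)+(D1b)+(D1c), landed R0/R0′/D1b/D1c (p138025 p138830 p140345
p138929); c3-1 (R1)|(B) merged into (M) (interface leak), `Theorems.stub_cruxOfWindowFloor` p141584; c4-1…c4-3 thin chain (T1)(T2)(T3)(M′),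
landed p143400 p142920 p142962 p144261 p144904; c5-1 this consolidation.
-/

set_option linter.dupNamespace false

namespace Summit.HubbardSuperconductivity.HubbardSuperconductivity.Cruxes.WcbcsBcsConstruction.LadderScaleCertifiedChain

open MeasureTheory Literature.MathematicalPhysics.QuantumLattice Literature.Probability.LatticeModels Matrix Filter
open Summit.HubbardSuperconductivity.HubbardSuperconductivity.Theses.WeakCouplingBCS
open Summit.HubbardSuperconductivity.HubbardSuperconductivity.Theses.ChiralWindow
open Summit.HubbardSuperconductivity.HubbardSuperconductivity.Theorems
open scoped Topology

/-! ### (P) The Kohn–Luttinger input from a ONE-POINT `U = 1` certificate — statements BYTE-IDENTICAL to stmt-1740 rev c7-1 -/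

open Summit.HubbardSuperconductivity.HubbardSuperconductivity.Theorems.CwKLChiralWindow in
/-- Stub (P1) — **from a `U = 1` leading inequality at a band level to (Kpt)** (shared with stmt-1740 rev c7-1, VERBATIM). If at
some `μ ∈ [-111/100, -21/25]` the `U = 1` channel bottoms satisfy `Λ₁(μ, B1g) + γ ≤ Λ₁(μ, χ)` for every `χ ≠ B1g` (`γ > 0`), then
(Kpt) holds at the doping `δ₀ := 1 - n(μ)`: the LANDED fillings `13/25 ≤ n(-111/100)` (`stub_klFillingLower`, p138691) and
`n(-21/25) < 7/10` (`stub_fillingBelowSevenTenths`, p139953) with `monotone_filling` put `δ₀` in `[3/10, 12/25]`;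
`chemicalPotentialOfDensity_spec` and `strictMonoOn_filling` give `μ(1 - δ₀) = μ`; `CwThesis.leading_of_certificateOne` turns the
`U = 1` margin `γ` into `γU²` for every `U ∈ (0, 1)` (`U²`-homogeneity off `A1g`, bare-`U` penalty for `A1g`). M-sized, provable now.
[cite: RaghuKivelsonScalapino2010, §II (7), (13)] -/
theorem stub_kptOfPointLeading :
    ∀ μ ∈ Set.Icc (-(111:ℝ) / 100) (-(21:ℝ) / 25), ∀ γ : ℝ, 0 < γ →
      (∀ χ : D4Irrep, χ ≠ D4Irrep.B1g →
        channelInf (squareDispersion 1 0) μ 1 D4Irrep.B1g + γ ≤ channelInf (squareDispersion 1 0) μ 1 χ) →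
      ∃ δ₀ ∈ Set.Icc (3/10 : ℝ) (12/25), ∃ γ' U₁ : ℝ, 0 < γ' ∧ 0 < U₁ ∧ ∀ U ∈ Set.Ioo (0:ℝ) U₁,
        ∀ χ : D4Irrep, χ ≠ D4Irrep.B1g →
          channelInf (squareDispersion 1 0) (chemicalPotentialOfDensity (squareDispersion 1 0) (1 - δ₀)) U D4Irrep.B1g
              + γ' * U ^ 2 ≤
            channelInf (squareDispersion 1 0) (chemicalPotentialOfDensity (squareDispersion 1 0) (1 - δ₀)) U χ :=
  -- CLOSED (lead 1740-c7 wave 1, 2026-08-17T07:31Z): landed p146657, `Theorems/ChiralWindowCwChiralConstructionKptOfPointLeading.lean`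
  Summit.HubbardSuperconductivity.HubbardSuperconductivity.Theorems.stub_kptOfPointLeading

open Summit.HubbardSuperconductivity.HubbardSuperconductivity.Theorems.CwKLChiralWindow in
/-- Stub (P2) — **certificate logic for ONE box** (shared with stmt-1740 rev c7-1, VERBATIM; stmt-1741's vocabulary,
record-generic). For a box `bx` with table `tab` whose ends lie in `(-4, 0)`, whose `B1g` block passes the `E_x`-form Temple
test, whose four other blocks each pass `lowerOKX` and which passes the rational test `b1gLeadsOKX tab γ`: at every level `μ` of
the box where the residual-form block enclosures hold, `Λ₁(μ, B1g) + γ ≤ Λ₁(μ, χ)` for every `χ ≠ B1g`. Proof: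
`stub_klBlockBoundsX` (landed) gives `Λ₁(μ, B1g) ≤ upper_B1g` (Ritz, case `B1g ≠ A1g`) and `lowerX_χ ≤ Λ₁(μ, χ)`; chain with the
rational test. S-sized, provable now. [cite: ReedSimonIV1978, Thm. XIII.5] -/
theorem stub_pointLeadingOfBox :
    ∀ (bx : KLBox) (tab : List KLTrig) (γ : ℚ), -4 < bx.mulo → bx.muhi < 0 →
      bx.bB1g.templeOKX tab D4Irrep.B1g = true →
      bx.bA1g.lowerOKX tab D4Irrep.A1g = true → bx.bA2g.lowerOKX tab D4Irrep.A2g = true →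
      bx.bB2g.lowerOKX tab D4Irrep.B2g = true → bx.bE.lowerOKX tab D4Irrep.E = true →
      bx.b1gLeadsOKX tab γ = true →
      ∀ μ ∈ Set.Icc ((bx.mulo : ℚ) : ℝ) ((bx.muhi : ℚ) : ℝ), (∀ χ : D4Irrep, (bx.blk χ).EnclosureR tab μ χ) →
        ∀ χ : D4Irrep, χ ≠ D4Irrep.B1g →
          channelInf (squareDispersion 1 0) μ 1 D4Irrep.B1g + ((γ : ℚ) : ℝ) ≤ channelInf (squareDispersion 1 0) μ 1 χ :=
  -- CLOSED (lead 1740-c7 wave 1, 2026-08-17T08:15Z): landed p148296, `Theorems/ChiralWindowCwChiralConstructionPointLeadingOfBox.lean`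
  Summit.HubbardSuperconductivity.HubbardSuperconductivity.Theorems.stub_pointLeadingOfBox

open Summit.HubbardSuperconductivity.HubbardSuperconductivity.Theorems.CwKLChiralWindow in
/-- Stub (Penc) — **the enclosures of the one-point record `klPtBox` at `μ_pt = -21/25`** (certified COMPUTATION; shared with
stmt-1740 rev c7-2, VERBATIM; the ONLY open piece of the KL input on either crux).  The record (`Theorems/ChiralWindowDefsPointRecord.lean`,
p145573, lead 1740-c7: table `klPtTab` of five trigonometric polynomials — the `B1g` trial = census bottom state (21 cosine terms
`cos(4ℤ+2)θ`), one `B1g`, one `A1g` and one quarter-turn pair of `E` deflation vectors — and the one-box `KLBox` literal `klPtBox`,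
`klPtGamma = 1/500`, Booleans decided by the kernel in `klPt_okX`) asks, at the single level `μ = -21/25`, for the residual-form enclosures
E1–E4 (`KLBlock.EnclosureR`) of its five blocks: for the `B1g` trial `Φ`: `999/1000 ≤ ∫Φ² dσ ≤ 1001/1000` (float `0.99999`),
`-3/40 ≤ ∫Φ(χ₀Φ) ≤ -29/500` (float `-0.064713`), `∫(χ₀Φ - sΦ)² ≤ 1/5000` with `s = -647/10000` (float `3e-8`), `∫∫(K_B1g - c u⊗u)² ≤ 3/500`
(float `4.27e-3`); and the deflated sector square masses `∫∫(K_χ - Σ c u⊗u)² ≤ 3/1000` for `A1g` (float `2.84e-4`), `A2g` (`7.90e-4`),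
`B2g` (`7.47e-4`), `E` (`1.46e-3`) — ten inequalities, the tightest with ×1.4 room; a certified kernel width `δ_A ≈ 1e-3` on `√w χ₀ √w'`
closes all of them (stmt-1741's crossing-window boxes need `1e-5`).  Target doc for the ccert lane: `Cruxes/CwChiralConstruction/PointCertTarget.md`.
[cite: RaghuKivelsonScalapino2010, §III Fig. 2] -/
theorem stub_klPointEnclosure : ∀ χ : D4Irrep, (klPtBox.blk χ).EnclosureR klPtTab (-(21:ℝ) / 25) χ := by
  sorry

open Summit.HubbardSuperconductivity.HubbardSuperconductivity.Theorems.CwKLChiralWindow in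
/-- (P3) — **the one-point certificate at `μ_pt = -21/25`** (shared with stmt-1740, VERBATIM; rev c5-1 registered this `∃ record`
form; rev c5-2: now WITNESSED by the sibling's concrete record `klPtBox`/`klPtTab`/`klPtGamma` with the kernel decision `klPt_okX`
(p145573), modulo the enclosure stub (Penc) — same five-line proof as the sibling's). Content: a one-box record `[μ_pt, μ_pt]` whose `B1g` trial block passes `templeOKX`, whose
`A1g`/`A2g`/`B2g`/`E` blocks pass `lowerOKX`, which passes `b1gLeadsOKX tab γ` with `γ > 0` — all DECIDABLE on the literal — and
whose residual-form enclosures E1–E4 HOLD at `μ_pt`: `Nlo ≤ ∫Φ² ≤ Nhi`, `Qlo ≤ ∫Φ(χ₀Φ) ≤ Qhi`, `∫(χ₀Φ - sΦ)² ≤ Thi` for the `B1g`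
trial and `∫∫(K_χ - Σ c u⊗u)² ≤ Hhi_χ` for the five sector kernels — seven loose inequalities (`Q` to ±15 %, `H` to +100 % and
more), certified kernel width `δ_A ≈ 1e-3` (1740-c7 float design: `Λ₁(B1g) = -0.0648`; deflated sector square masses
`A1g 2.6e-4`, `A2g 4.3e-5`, `B2g 3.6e-4`, `E 9.4e-4`). [cite: RaghuKivelsonScalapino2010, §III Fig. 2] -/
theorem stub_klPointCertificate :
    ∃ (bx : KLBox) (tab : List KLTrig) (γ : ℚ), 0 < γ ∧ bx.mulo = -21 / 25 ∧ bx.muhi = -21 / 25 ∧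
      bx.bB1g.templeOKX tab D4Irrep.B1g = true ∧
      bx.bA1g.lowerOKX tab D4Irrep.A1g = true ∧ bx.bA2g.lowerOKX tab D4Irrep.A2g = true ∧
      bx.bB2g.lowerOKX tab D4Irrep.B2g = true ∧ bx.bE.lowerOKX tab D4Irrep.E = true ∧
      bx.b1gLeadsOKX tab γ = true ∧
      ∀ χ : D4Irrep, (bx.blk χ).EnclosureR tab (-(21:ℝ) / 25) χ := by
  obtain ⟨hγ, hlo, hhi, htB, hA1, hA2, hB2, hE, hlead⟩ := klPt_okX
  exact ⟨klPtBox, klPtTab, klPtGamma, hγ, hlo, hhi, htB, hA1, hA2, hB2, hE, hlead, stub_klPointEnclosure⟩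

open Summit.HubbardSuperconductivity.HubbardSuperconductivity.Theorems.CwKLChiralWindow in
/-- **(Kpt) from the one-point certificate** (the sibling's `stub_klLeadingAtWindowDoping`, same five-line proof): (P3) read
through (P2) at `μ_pt = -21/25` is a `U = 1` leading inequality at a band level in `[-111/100, -21/25]`, which (P1) turns into
`B₁g` leading by `γU²` at one window doping `δ₀ ∈ [3/10, 12/25]` for all `U < U₁`. [cite: RaghuKivelsonScalapino2010, §III Fig. 2] -/
theorem klLeadingAtWindowDoping_of_point :
    ∃ δ₀ ∈ Set.Icc (3/10 : ℝ) (12/25), ∃ γ U₁ : ℝ, 0 < γ ∧ 0 < U₁ ∧ ∀ U ∈ Set.Ioo (0:ℝ) U₁,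
      ∀ χ : D4Irrep, χ ≠ D4Irrep.B1g →
        channelInf (squareDispersion 1 0) (chemicalPotentialOfDensity (squareDispersion 1 0) (1 - δ₀)) U D4Irrep.B1g
            + γ * U ^ 2 ≤
          channelInf (squareDispersion 1 0) (chemicalPotentialOfDensity (squareDispersion 1 0) (1 - δ₀)) U χ := by
  obtain ⟨bx, tab, γ, hγ, hlo, hhi, htB, hA1, hA2, hB2, hE, hlead, hencl⟩ := stub_klPointCertificate
  have hlo' : ((bx.mulo : ℚ) : ℝ) = -(21:ℝ) / 25 := by rw [hlo]; push_cast; ring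
  have hhi' : ((bx.muhi : ℚ) : ℝ) = -(21:ℝ) / 25 := by rw [hhi]; push_cast; ring
  have hpt := stub_pointLeadingOfBox bx tab γ (by rw [hlo]; norm_num) (by rw [hhi]; norm_num) htB hA1 hA2 hB2 hE hlead
    (-(21:ℝ) / 25) ⟨le_of_eq hlo', le_of_eq hhi'.symm⟩ hencl
  exact stub_kptOfPointLeading (-(21:ℝ) / 25) ⟨by norm_num, le_rfl⟩ ((γ : ℚ) : ℝ) (by exact_mod_cast hγ) hpt

/-- **The Kohn–Luttinger level window** (proved from (P1)(P2)(P3) and LANDED pieces): there is a level window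
`[μ₁, μ₂] ⊂ [-2, -3/10]` with certified free fillings `13/25 < n(μ₁)`, `n(μ₂) < 7/10` and `γ, U₁ > 0` such that `B₁g` leads every
other channel of the second-order vertex by `γU²` at every `μ ∈ [μ₁, μ₂]` and every `U ∈ (0, U₁)`.  Proof: (Kpt) ⟹ (Kwin)
`Theorems.stub_klLeadingMuWindowOfPoint` (p141740) a window with those fillings inside `(-4, 0)`; the landed `n(-2) ≤ 1/2`
(`filling_neg_two_le_half'`) and `7/10 ≤ n(-3/10)` (`stub_fillingAtNegThreeTenths`) with the monotone free filling place it inside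
`[-2, -3/10]`. [cite: RaghuKivelsonScalapino2010, §II (7), (13)] -/
theorem klLeadingLevelWindow :
    ∃ μ₁ μ₂ γ U₁ : ℝ, -2 ≤ μ₁ ∧ μ₁ < μ₂ ∧ μ₂ ≤ -(3:ℝ) / 10 ∧ 0 < γ ∧ 0 < U₁ ∧
      13 / 25 < KohnLuttinger.filling (squareDispersion 1 0) μ₁ ∧
      KohnLuttinger.filling (squareDispersion 1 0) μ₂ < 7 / 10 ∧
      ∀ U ∈ Set.Ioo (0:ℝ) U₁, ∀ μ ∈ Set.Icc μ₁ μ₂, ∀ χ : D4Irrep, χ ≠ D4Irrep.B1g →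
        channelInf (squareDispersion 1 0) μ U D4Irrep.B1g + γ * U ^ 2 ≤ channelInf (squareDispersion 1 0) μ U χ := by
  obtain ⟨μ₁, μ₂, γ, U₁, -, h12, -, hγ, hU₁, hn₁, hn₂, hK⟩ :=
    stub_klLeadingMuWindowOfPoint klLeadingAtWindowDoping_of_point
  have hμ₁ : -2 ≤ μ₁ := by
    by_contra hlt
    have hlt : μ₁ < -2 := not_le.mp hlt
    have := monotone_filling hlt.le
    linarith [filling_neg_two_le_half']
  have hμ₂ : μ₂ ≤ -(3:ℝ) / 10 := by
    by_contra hlt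
    have hlt : -(3:ℝ) / 10 < μ₂ := not_le.mp hlt
    have := monotone_filling hlt.le
    linarith [stub_fillingAtNegThreeTenths]
  exact ⟨μ₁, μ₂, γ, U₁, hμ₁, h12, hμ₂, hγ, hU₁, hn₁, hn₂, hK⟩

/-! ### (M_loc) The Kohn–Luttinger mechanism, local uniform form — THE shared research stub (registered for PROMOTION) -/

/-- Stub (M_loc) — **the Kohn–Luttinger mechanism in local uniform form** (XL; OPEN RESEARCH = the weak-coupling constructive
programme, symmetric AND broken regime; VERBATIM the registered stub `stub_dWaveOrderFloorOnLeadingWindows` of stmt-1740 — ONE promoted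
item serves both cruxes; registered for PROMOTION, not for a worker). For every level window `[μ₁, μ₂] ⊂ [-2, -3/10]` on which `B₁g`
leads every other channel of the second-order vertex by `γU²` for all `U < U₁`, there are `U₀, C > 0` with
`e^{-C/U²} ≤ dWaveOrderParameter U μ` for every `U ∈ (0, U₀)` and every operator level `μ ∈ [μ₁ + U/2, μ₂]` (Grassmann `ν = μ - U/2`,
frame note of rattack-14045).  rev c3-1's (M) is the instance `[μ₁, μ₂] = [-9/10, -3/10]` (sibling skeleton,
`siblingFloor_of_leadingWindows`).  MECHANISM (intended proof): multiscale fermionic RG in the symmetric regime (BGM2006 above `e^{-a/U}`,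
then irrep-resolved Cooper flow with the `B₁g` ladder fed by `γU²` and stopped at `λ_d ≍ 1/8` at a ladder scale `s ≥ e^{-C₁/U²}`), then
the `h`-seeded broken-regime expansion below the ladder scale (large-`N` BCS, FMRT 1993), `m ≈ ρ_d Δ log(Λ/Δ) ≥ c·s ≥ e^{-(C₁+1)/U²}`; the
v3-certificate refinement (Rloc) → (B) → (M_loc) is kernel-checked in the sibling skeleton and is NOT a cut (lead c3,
`R1B-interface-leak.md`). Why it might fail: no construction controls a symmetric 2D Fermi surface below `T ≍ e^{-a/|U|}` (barrier
`WeakCouplingCeiling`), and no constructive control of continuous `U(1)` breaking with a Goldstone mode exists for any short-range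
Fermi-surface model. NOT implied by the crux (uniform in the window, explicit KL hypothesis); with (P1)(P2)(P3) and (D_loc)(Bgen) it
implies the crux (`WcbcsBcsConstruction_of`), with (P1)(P2)(P3) alone the sibling crux and the thin crux. [cite: KohnLuttinger1965]
[cite: BenfattoGiulianiMastropietro2006, Theorem 1.1] [cite: FeldmanKnorrerTrubowitz2004, §1] [cite: KomaTasaki1994, §1] -/
theorem stub_dWaveOrderFloorOnLeadingWindows :
    ∀ μ₁ μ₂ γ U₁ : ℝ, -2 ≤ μ₁ → μ₁ < μ₂ → μ₂ ≤ -(3:ℝ) / 10 → 0 < γ → 0 < U₁ →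
      (∀ U ∈ Set.Ioo (0:ℝ) U₁, ∀ μ ∈ Set.Icc μ₁ μ₂, ∀ χ : D4Irrep, χ ≠ D4Irrep.B1g →
        channelInf (squareDispersion 1 0) μ U D4Irrep.B1g + γ * U ^ 2 ≤ channelInf (squareDispersion 1 0) μ U χ) →
      ∃ U₀ C : ℝ, 0 < U₀ ∧ 0 < C ∧ ∀ U ∈ Set.Ioo (0:ℝ) U₀, ∀ μ ∈ Set.Icc (μ₁ + U / 2) μ₂,
        Real.exp (-C / U ^ 2) ≤ dWaveOrderParameter U μ := by
  sorry

/-! ### The thin chain: sibling crux ⇒ thin crux ⇒ (with crux 2) the SUMMIT — no stub of its own -/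

/-- **The sibling crux from the shared stubs** (the sibling skeleton's `CwChiralConstruction_of`, same proof): (P1)(P2)(P3) give the
level window, (M_loc) the floor on `[μ₁ + U/2, μ₂]`, and the sibling's landed record-free transfer
`Theorems.stub_cruxOfOrderFloorOnCertifiedLevelWindow` (p142268; generic-`μ` density frame inside) concludes `CwChiralConstruction`.
[cite: KomaTasaki1994, §1] -/
theorem cwChiralConstruction_of_chain : CwChiralConstruction := by
  obtain ⟨μ₁, μ₂, γ, U₁, hμ₁, h12, hμ₂, hγ, hU₁, hn₁, hn₂, hK⟩ := klLeadingLevelWindow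
  exact stub_cruxOfOrderFloorOnCertifiedLevelWindow μ₁ μ₂ h12 hn₁ hn₂
    (stub_dWaveOrderFloorOnLeadingWindows μ₁ μ₂ γ U₁ hμ₁ h12 hμ₂ hγ hU₁ hK)

/-- **The sibling crux implies the thin crux** (NEW, rev c5-1; landed structurally in
`Theorems/WeakCouplingBCSWcbcsBcsConstructionThinCruxOfChiralConstruction.lean`): `CwChiralConstruction` produces, for every `U < U₀`, a
doping `δ(U) ∈ [3/10, 12/25] ⊂ (0, 1/2)` and a density-matched `μ` with the floor `e^{-C/U²} ≤ m(U, μ)`, hence `HasDWaveOrder U μ`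
(`hasDWaveOrder_iff`, `Real.exp_pos`); given `U₁ > 0` take `U := min U₀ U₁ / 2`. [cite: KomaTasaki1994, §1] -/
theorem thinCrux_of_cwChiralConstruction (h : CwChiralConstruction) :
    ∀ U₁ : ℝ, 0 < U₁ → ∃ U ∈ Set.Ioo (0:ℝ) U₁, ∃ δ ∈ Set.Ioo (0:ℝ) (1 / 2), ∃ μ : ℝ,
      Tendsto (fun L : ℕ => ((hubbardTorusWith 2 (L + 1) 1 U μ).groundStateFunctional
        totalNumber).re / ((L + 1 : ℕ) : ℝ) ^ 2) atTop (𝓝 (1 - δ)) ∧ HasDWaveOrder U μ :=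
  -- LANDED (lead c5, rev c5-1): p146793, `Theorems/WeakCouplingBCSWcbcsBcsConstructionThinCruxOfChiralConstruction.lean`
  wcbcs_thinCrux_of_cwChiralConstruction h

/-- **The thin line closes the SUMMIT modulo the shared stubs**: crux 2 `WcbcsSsbToTorusLRO` BY NAME, (P1)(P2)(P3)(M_loc) through the
sibling crux, and lead c4's landed thin glue `hubbardSuperconductivity_of_wcbcsSsbToTorusLRO_of_thinCrux` (p144261).
[cite: KomaTasaki1994, §1] -/
theorem hubbardSuperconductivity_of_ssbToTorusLRO (h2 : WcbcsSsbToTorusLRO) : _root_.HubbardSuperconductivity :=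
  hubbardSuperconductivity_of_wcbcsSsbToTorusLRO_of_thinCrux h2 (thinCrux_of_cwChiralConstruction cwChiralConstruction_of_chain)

/-! ### The equation-of-state side of the TYPED crux (U-uniform `δ`): one research stub, one provable stub -/

/-- Stub (D_loc) — **no density jump on level windows at weak coupling** (L–XL; OPEN; the content of the strategist's stub (D),
re-windowed from rev c2-2's (D1a) `[-4/5, -7/20]` to the level windows the KL input delivers).  For every level window
`[μ₁, μ₂] ⊂ [-2, -3/10]` there is `U_J > 0` such that for every `U ∈ (0, U_J)` and every `ν ∈ [μ₁, μ₂]` the grand-canonical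
ground-state densities `n_L(U,·)` of `hubbardTorusWith 2 (L+1) 1 U ·` have no jump at `ν`: `∀ ε > 0 ∃ h > 0`, for infinitely many `L`,
`n_L(U,ν+h) - n_L(U,ν-h) ≤ ε` (⟺ differentiability at `ν` of the limiting energy density `e(U,·)`, landed
`wcbcs_eos_differentiableAt_of_noDensityJump` / `wcbcs_noDensityJump_of_differentiableAt`).  Needed ONLY to place one `U`-uniform `δ`
(the typed crux); the thin crux and the summit do not use it.  Why it might fail: a first-order density jump (phase separation)
inside `[-2, -3/10]` (free fillings `0.37…0.85`) for a sequence `U_n → 0⁺` — not expected at `t' = 0` away from half filling (jumps are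
confined to `O(√U)`, p84150), no theorem either way; a construction proving (M_loc) delivers it as a by-product (free energy `C¹` in `μ`
uniformly in `h`, p84295).  NOT implied by the crux. [folklore] -/
theorem stub_noDensityJumpOnLevelWindows :
    ∀ μ₁ μ₂ : ℝ, -2 ≤ μ₁ → μ₁ < μ₂ → μ₂ ≤ -(3:ℝ) / 10 → ∃ U_J : ℝ, 0 < U_J ∧ ∀ U ∈ Set.Ioo (0:ℝ) U_J,
      ∀ ν ∈ Set.Icc μ₁ μ₂, ∀ ε > 0, ∃ h > 0, ∃ᶠ L : ℕ in atTop,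
        ((hubbardTorusWith 2 (L + 1) 1 U (ν + h)).groundStateFunctional totalNumber).re / ((L + 1 : ℕ) : ℝ) ^ 2 -
          ((hubbardTorusWith 2 (L + 1) 1 U (ν - h)).groundStateFunctional totalNumber).re / ((L + 1 : ℕ) : ℝ) ^ 2 ≤ ε := by
  sorry

/-- Stub (Bgen) — **the generic free/interacting density sandwich** (M; provable now; replaces the certified level counts of revs
c2–c4).  For every `U ≥ 0`, every `μ` and every step `r > 0`:
`limsup_L n_L(U,μ) ≤ F(μ+r) + U/r` and `F(μ-r) - U/r ≤ liminf_L n_L(U,μ)`, `F = KohnLuttinger.filling (squareDispersion 1 0)` the free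
filling (continuum, both spins) and `n_L(U,μ) = Re ω₀[hubbardTorusWith 2 (L+1) 1 U μ](N)/(L+1)²`.  Proof sketch: Griffiths at finite
volume `r·n_L(U,μ) ≤ (E_L(U,μ) - E_L(U,μ+r))/V_L` (`gcNumber_torus_mem_Icc_slope`), the limits `E_L/V_L → e(U,·)` (p76736,
`wcbcs_eos_tendsto`), the interaction sandwich `0 ≤ e(U,·) - e(0,·) ≤ U` (`wcbcs_eos_sub_free_mem_Icc`), the free limit with
`e₀' = -F` (`Theorems.stub_freeBandLimit`, so `e(0,·) = e₀` by uniqueness of limits) and the mean value theorem with the monotone `F`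
(`monotone_filling`): `e₀(μ) - e₀(μ+r) ≤ r·F(μ+r)`; densities lie in `[0, 2]` (`gcDensity_torus_mem_Icc`) so `limsup`/`liminf` are
honest. [folklore: Griffiths 1964] -/
theorem stub_gcDensitySandwichFree :
    ∀ U μ r : ℝ, 0 ≤ U → 0 < r →
      limsup (fun L : ℕ => ((hubbardTorusWith 2 (L + 1) 1 U μ).groundStateFunctional
          totalNumber).re / ((L + 1 : ℕ) : ℝ) ^ 2) atTop ≤
        KohnLuttinger.filling (squareDispersion 1 0) (μ + r) + U / r ∧
      KohnLuttinger.filling (squareDispersion 1 0) (μ - r) - U / r ≤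
        liminf (fun L : ℕ => ((hubbardTorusWith 2 (L + 1) 1 U μ).groundStateFunctional
          totalNumber).re / ((L + 1 : ℕ) : ℝ) ^ 2) atTop :=
  -- CLOSED (lead c5 wave 1, 2026-08-17): landed p148887, `Theorems/WeakCouplingBCSWcbcsBcsConstructionGcDensitySandwichFree.lean`
  Summit.HubbardSuperconductivity.HubbardSuperconductivity.Theorems.stub_gcDensitySandwichFree

/-! ### Composition: (P1)(P2)(P3)(M_loc)(D_loc)(Bgen) imply the TYPED crux BY NAME -/

/-- **The line closes the crux modulo its stubs (rev c5-1).**  Window `[m, μ₂]`, `m = (μ₁+μ₂)/2`, of the KL level window; step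
`r = (μ₂-m)/6`; brackets `1-b = F(m+2r) < F(μ₂-2r) = 1-a` inside `(13/25, 7/10)`; (D_loc) ⟹ `e(U,·)` differentiable on `[m, μ₂]`,
density limits `-e'`; (Bgen) at `U ≤ U_B := r·min(F(m+2r)-F(m+r), F(μ₂-r)-F(μ₂-2r))` ⟹ `-e'(m) ≤ 1-b`, `1-a ≤ -e'(μ₂)`; Darboux
(`exists_tendsto_gcDensity_of_regularWindow`) ⟹ `μ(U) ∈ [m, μ₂]` with density `→ 1-a`; (M_loc) ⟹ floor at `μ(U)` (`m ≥ μ₁ + U/2` for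
`U ≤ μ₂-μ₁`).  `δ := a`, `U₀ := min U₀ᴹ (min U_J (min U_B (μ₂-μ₁)))`. [cite: KomaTasaki1994, §1] -/
theorem WcbcsBcsConstruction_of : WcbcsBcsConstruction := by
  obtain ⟨μ₁, μ₂, γ, U₁, hμ₁, h12, hμ₂, hγ, hU₁, hn₁, hn₂, hK⟩ := klLeadingLevelWindow
  obtain ⟨U₀, C, hU₀, hC, hM⟩ := stub_dWaveOrderFloorOnLeadingWindows μ₁ μ₂ γ U₁ hμ₁ h12 hμ₂ hγ hU₁ hK
  -- the EOS window `[m, μ₂]` and the step `r`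
  set m : ℝ := (μ₁ + μ₂) / 2 with hm
  have hm₁ : μ₁ < m := by rw [hm]; linarith
  have hm₂ : m < μ₂ := by rw [hm]; linarith
  obtain ⟨U_J, hUJ, hJ⟩ := stub_noDensityJumpOnLevelWindows m μ₂ (by linarith) hm₂ hμ₂
  set r : ℝ := (μ₂ - m) / 6 with hr
  have hrpos : 0 < r := by rw [hr]; linarith
  set F : ℝ → ℝ := KohnLuttinger.filling (squareDispersion 1 0) with hF
  -- all points used lie in `[-4, 4]`, where the free filling is strictly increasing
  have hI : ∀ x : ℝ, μ₁ ≤ x → x ≤ μ₂ → x ∈ Set.Icc (-4:ℝ) 4 := fun x h1 h2 =>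
    ⟨by linarith, by linarith⟩
  have hF1 : F (m + r) < F (m + 2 * r) :=
    strictMonoOn_filling (hI _ (by linarith) (by linarith)) (hI _ (by linarith) (by linarith)) (by linarith)
  have hF2 : F (m + 2 * r) < F (μ₂ - 2 * r) :=
    strictMonoOn_filling (hI _ (by linarith) (by linarith)) (hI _ (by linarith) (by linarith)) (by linarith)
  have hF3 : F (μ₂ - 2 * r) < F (μ₂ - r) :=
    strictMonoOn_filling (hI _ (by linarith) (by linarith)) (hI _ (by linarith) (by linarith)) (by linarith)
  have hFlo : F μ₁ ≤ F (m + 2 * r) := monotone_filling (by linarith)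
  have hFhi : F (μ₂ - 2 * r) ≤ F μ₂ := monotone_filling (by linarith)
  -- the doping bracket `a < b` inside `(0, 1/2)`
  set a : ℝ := 1 - F (μ₂ - 2 * r) with ha
  set b : ℝ := 1 - F (m + 2 * r) with hb
  have ha0 : 0 < a := by rw [ha]; linarith
  have hab : a < b := by rw [ha, hb]; linarith
  have hb2 : b < 1 / 2 := by rw [hb]; linarith
  -- the coupling threshold of the brackets
  set U_B : ℝ := r * min (F (m + 2 * r) - F (m + r)) (F (μ₂ - r) - F (μ₂ - 2 * r)) with hUB
  have hUBpos : 0 < U_B := mul_pos hrpos (lt_min (by linarith) (by linarith))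
  refine ⟨a, ⟨ha0, hab.trans hb2⟩, min U₀ (min U_J (min U_B (μ₂ - μ₁))),
    lt_min hU₀ (lt_min hUJ (lt_min hUBpos (by linarith))), C, hC, fun U hU => ?_⟩
  have hUpos : 0 < U := hU.1
  have hUU₀ : U < U₀ := lt_of_lt_of_le hU.2 (min_le_left _ _)
  have hUUJ : U < U_J := lt_of_lt_of_le hU.2 ((min_le_right _ _).trans (min_le_left _ _))
  have hUUB : U < U_B := lt_of_lt_of_le hU.2 ((min_le_right _ _).trans ((min_le_right _ _).trans (min_le_left _ _)))
  have hUw : U < μ₂ - μ₁ := lt_of_lt_of_le hU.2 ((min_le_right _ _).trans ((min_le_right _ _).trans (min_le_right _ _)))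
  -- (D_loc): the limiting equation of state is differentiable on `[m, μ₂]`
  set e : ℝ → ℝ := fun y : ℝ => limUnder atTop (fun L : ℕ =>
    (hubbardTorusWith 2 (L + 1) 1 U y).groundEnergy / ((L + 1 : ℕ) : ℝ) ^ 2) with he
  have hdiff : ∀ ν ∈ Set.Icc m μ₂, DifferentiableAt ℝ e ν := fun ν hν =>
    wcbcs_eos_differentiableAt_of_noDensityJump U ν (hJ U ⟨hUpos, hUUJ⟩ ν hν)
  have hlim : ∀ μ' : ℝ, Tendsto (fun L : ℕ => (hubbardTorusWith 2 (L + 1) 1 U μ').groundEnergy /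
      ((L + 1 : ℕ) : ℝ) ^ 2) atTop (𝓝 (e μ')) := fun μ' => wcbcs_tendsto_gcEnergyDensity_limUnder U μ'
  have hder : ∀ μ' ∈ Set.Icc m μ₂, HasDerivAt e (deriv e μ') μ' := fun μ' hμ' => (hdiff μ' hμ').hasDerivAt
  -- density limits at the two ends, bracketed by (Bgen)
  have hmI : m ∈ Set.Icc m μ₂ := ⟨le_rfl, hm₂.le⟩
  have hμ₂I : μ₂ ∈ Set.Icc m μ₂ := ⟨hm₂.le, le_rfl⟩
  have hTm := wcbcs_tendsto_gcDensity_of_differentiableAt U m (hdiff m hmI)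
  have hTμ₂ := wcbcs_tendsto_gcDensity_of_differentiableAt U μ₂ (hdiff μ₂ hμ₂I)
  obtain ⟨hBm, -⟩ := stub_gcDensitySandwichFree U m r hUpos.le hrpos
  obtain ⟨-, hBμ₂⟩ := stub_gcDensitySandwichFree U μ₂ r hUpos.le hrpos
  rw [hTm.limsup_eq] at hBm
  rw [hTμ₂.liminf_eq] at hBμ₂
  have hUr1 : U / r ≤ F (m + 2 * r) - F (m + r) := by
    rw [div_le_iff₀ hrpos]
    calc U ≤ U_B := hUUB.le
      _ ≤ r * (F (m + 2 * r) - F (m + r)) := by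
          rw [hUB]; exact mul_le_mul_of_nonneg_left (min_le_left _ _) hrpos.le
      _ = (F (m + 2 * r) - F (m + r)) * r := by ring
  have hUr2 : U / r ≤ F (μ₂ - r) - F (μ₂ - 2 * r) := by
    rw [div_le_iff₀ hrpos]
    calc U ≤ U_B := hUUB.le
      _ ≤ r * (F (μ₂ - r) - F (μ₂ - 2 * r)) := by
          rw [hUB]; exact mul_le_mul_of_nonneg_left (min_le_right _ _) hrpos.le
      _ = (F (μ₂ - r) - F (μ₂ - 2 * r)) * r := by ring
  have h₁ : -deriv e m ≤ 1 - b := by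
    have : 1 - b = F (m + 2 * r) := by rw [hb]; ring
    rw [this]; linarith
  have h₂ : 1 - a ≤ -deriv e μ₂ := by
    have : 1 - a = F (μ₂ - 2 * r) := by rw [ha]; ring
    rw [this]; linarith
  -- Darboux–Griffiths: a density-matched `μ(U) ∈ [m, μ₂]` at doping `a`
  obtain ⟨μ, hμ, hdens⟩ := exists_tendsto_gcDensity_of_regularWindow 1 U hm₂.le hlim hder h₁ h₂
    (δ := a) ⟨le_rfl, hab.le⟩
  -- (M_loc): the floor at `μ(U) ∈ [m, μ₂] ⊆ [μ₁ + U/2, μ₂]`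
  have hμ' : μ ∈ Set.Icc (μ₁ + U / 2) μ₂ := ⟨by rw [hm] at hμ; linarith [hμ.1], hμ.2⟩
  exact ⟨μ, hdens, hM U ⟨hUpos, hUU₀⟩ μ hμ'⟩

/-! ### Sanity anchors (no new content) -/

/-- The adversary's uniform ceiling (Negative/UniformCeiling, p91737): `dWaveOrderParameter U μ ≤ 71·U^{1/4}` for `U ≥ 0`.
Any floor a line produces must be consistent with it; `e^{-C/U²}` is. Re-exported so the skeleton's check imports the landed
Negative lemma (crux protocol). [cite: KomaTasaki1994, §1] -/
theorem ceiling_anchor (U μ : ℝ) (hU : 0 ≤ U) : dWaveOrderParameter U μ ≤ 71 * Real.sqrt (Real.sqrt U) :=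
  Summit.HubbardSuperconductivity.HubbardSuperconductivity.Theorems.WcbcsBcsConstruction.Negative.dWaveOrderParameter_le_uniformCeiling
    hU μ

/-- **rev c4-3's thin order (M′) is implied by the new chain** (so nothing c4 registered is lost): from the sibling crux's floor on a
level window `[μ₁ + U/2, μ₂]`… — not needed by any composition; recorded only as the implication typed crux ⇒ thin crux, which lead c4
landed (`wcbcs_thinCrux_of_wcbcsBcsConstruction`, p144261), here re-derived from this file's `WcbcsBcsConstruction_of`.
[cite: KomaTasaki1994, §1] -/
theorem thinCrux_of_chain :
    ∀ U₁ : ℝ, 0 < U₁ → ∃ U ∈ Set.Ioo (0:ℝ) U₁, ∃ δ ∈ Set.Ioo (0:ℝ) (1 / 2), ∃ μ : ℝ,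
      Tendsto (fun L : ℕ => ((hubbardTorusWith 2 (L + 1) 1 U μ).groundStateFunctional
        totalNumber).re / ((L + 1 : ℕ) : ℝ) ^ 2) atTop (𝓝 (1 - δ)) ∧ HasDWaveOrder U μ :=
  thinCrux_of_cwChiralConstruction cwChiralConstruction_of_chain

end Summit.HubbardSuperconductivity.HubbardSuperconductivity.Cruxes.WcbcsBcsConstruction.LadderScaleCertifiedChain
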